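import Mathlib
import Literature.Claims.NS.ClayVariants
import HarnessLib

/-!
# CLAIM C123 — M. Iizumi, «Lean4: Four-Branch Formal Architecture for 3D Navier–Stokes Regularity»
# (Zenodo record 19624809 = v1.0.1, 2026-04-17; Lean 4 project `NSBarrier`, mathlib v4.29.0)

QUICK Lean-artefact row of the D-0090 NS-CLAIMS sweep (C81/C109/C110 treatment; lead RULINGS v1.26 (5):
«C123's TYPES decide which of its four branches is asserted»). Sources: `run/shared/lean/pub/ns-claims/
sources/Iizumi2026/` — the Zenodo record (`deposit/rec.json`), the deposit's PROSE (`deposit/description.txt`)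
and the unpacked project `unpacked/…-20dc14f/lean4/NSBarrier_lean4/*.lean` (159 files; lit-1 g4 census:
0 sorry / 0 axiom; NOT compiled in-cell); LOCATORS.md by ns-claims-lit-1 g4. Locators «File.lean:l.N» are the
deposit's files. Bib key `Iizumi2026`. NOTHING here asserts a claim of the deposit: its four terminal TYPES
are re-typed VERBATIM over re-declared parameters (the structures below carry exactly the fields the TYPES
read), and what the kernel says about those TYPES is PROVED.

WHAT THIS IS NOT: not a claim about NS regularity or blow-up; not a claim about any author beyond the typed
locator.

## The deposit's prose (description.txt) and its disclaimer

«This release extends the formal architecture to cover all four standard regularity branches of the 3D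
incompressible Navier–Stokes problem, on both the torus T³ and the Euclidean domain R³, under a single
irreducible PDE assumption ω₀ ∈ L².» · «Four Named Final Theorems … T³ (B) Global regularity
`torus_global_smooth_solution_of_smooth_data` (NSTorusGlobalRegularity.lean) · R³ (A) Global regularity
`R3_global_smooth_solution_of_smooth_data` (NSR3GlobalRegularity.lean) · T³ (D) Breakdown counterexample
`exists_torus_breakdown_counterexample` (NSTorusBreakdownExistence.lean) · R³ (C) Breakdown counterexample
`exists_breakdown_counterexample_R3` (NSR3BreakdownExistence.lean).» · «The authors make no claim regarding
the resolution of the Clay Millennium Problem. The scope and interpretation of such claims rests with the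
Clay Mathematics Institute.»

## The four terminal TYPES (verbatim) and their unfoldings in the deposit

* (B) `NSTorusGlobalRegularity.lean` l.26–55, (A) `NSR3GlobalRegularity.lean` l.27–55 (same shape):
  `theorem …_global_smooth_solution_of_smooth_data {K_max m : ℕ} (d : …NoBlowupData K_max m) :
  (∀ n : ℕ, ∃ B : ℝ, 0 ≤ B ∧ shiftedLimitEnstrophy d n ≤ B) ∧ (∀ n : ℕ, 0 ≤ bootstrapStrainSup ((1 + M C)^n E0)
  strainHigh F_low ∧ bootstrapStrainSup (…) strainHigh F_low = F_low ((1 + M C)^n E0) + strainHigh) ∧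
  (∀ n : ℕ, 0 ≤ T0 + Δt * n)` — with `shiftedLimitEnstrophy d : ℕ → ℝ := fun n => Elim (N0 + n)`
  (NSTorusNoBlowup.lean l.41–47: a real SEQUENCE), `bootstrapStrainSup B s F := F B + s`
  (NSStrainSupBootstrap.lean l.178–180), `InductiveContinuationData` (NSContinuationCriterion.lean l.95–113:
  `Δt > 0`, `0 ≤ M`, `0 ≤ M*C`, `0 ≤ E0`, `F_low ≥ 0` on `[0,∞)`, `0 ≤ strainHigh`, `(1 + M C)^m E0 ≥ 0`),
  `LocalExistenceSeed.T0 > 0` (NSGalerkinExistenceTheorems.lean l.118–125). Typed: `NoBlowupInput`, `TypeAB`.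
* (D) `NSTorusBreakdownExistence.lean` l.17–27, (C) `NSR3BreakdownExistence.lean` l.17–46 (same shape):
  `theorem exists_…_breakdown_counterexample (d : …BreakdownFrontierData …) : ∃ ce : …SmoothCounterexampleData …,
  …_breakdown_predicate ce.witness.pkg ∧ (MillenniumFrontierHypothesis → False)` — with
  `DiscreteBlowupAt (E : ℕ → ℝ) nstar := ∀ B : ℝ, E nstar > B`, `DiscreteBreakdown E := ∃ nstar, DiscreteBlowupAt E
  nstar` (NSTorusBreakdownDefinition.lean l.9–17 = NSR3BreakdownDefinition.lean l.13–15), the witness structure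
  `TorusBreakdownWitness` (l.20–23) with field `hblowup : DiscreteBlowupAt (torusEnstrophyTrajectory pkg) nstar`,
  `…SmoothCounterexampleData` (NSTorusCounterexampleData.lean l.26–29) with field `witness`, the INPUT
  `…BreakdownFrontierData` (NSTorusBreakdownToFrontier.lean l.15–28) with field `counterexampleData` and the
  proof l.24–26 `⟨d.counterexampleData, …⟩`; `MillenniumFrontierHypothesis` (NSMillenniumFrontier.lean l.50–56) =
  `{F : ℝ → ℝ, hF_nonneg, hF_mono : Monotone F, hF_Kmax_independent : True}`. Typed: `BreakdownWitness`,
  `FrontierHypothesis`, `BreakdownInput`, `TypeCD`.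

## Ordered step index

* Step 1 = `Step1_bridgeA` / `Step1_bridgeB` — description § «Four Named Final Theorems»: the (A)/(B) TYPE
  «completed as an end-to-end named theorem surface» for Clay (A)/(B). Kernel facts: `typeAB_holds` (the TYPE
  holds for EVERY input — real arithmetic), hence `step1_bridgeA_iff` / `step1_bridgeB_iff` (the bridge IS the
  Clay statement; ROUTE 5b shape).
* Step 2 = `Step2_bridgeC` / `Step2_bridgeD` — the (C)/(D) TYPE for Clay (C)/(D). Kernel facts:
  `isEmpty_breakdownWitness` (no real exceeds every real ⇒ the witness type, hence the INPUT type, is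
  uninhabited: `isEmpty_breakdownInput`), `typeCD_holds` (vacuously), `not_conclusionCD` (the TYPE's conclusion,
  read as a closed statement, is FALSE), `step2_bridgeC_iff` / `step2_bridgeD_iff`.
* `ClaimedTheorem` := the four TYPES; `claimedTheorem_holds` PROVED. COMPOSITION: `clay_of_bridges` — the Clay
  statements follow from the bridges alone (the TYPES contribute nothing). Clay delta: Δ5/Δ6 SOLUTION NOTION /
  FORM OF CONCLUSION on every branch (no velocity field, PDE, time variable or smoothness occurs in any TYPE),
  recorded by the `_iff` lemmas; Δ-CLAIM: the prose disclaims a Millennium claim.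
-/

open Set Function

namespace Literature.Claims.NS.Iizumi2026

noncomputable section

/-! ## (A)/(B): the inputs the terminal TYPE reads, and the TYPE -/

/-- The parameters read by the (A)/(B) terminal TYPE: the «limit enstrophy trajectory» `E : ℕ → ℝ`
(= `shiftedLimitEnstrophy d`, a real sequence indexed by the discrete step), the continuation constants of
`InductiveContinuationData` with their packaged signs, and the seed time `T0 > 0` of `LocalExistenceSeed`.
[cite: Iizumi2026, NSTorusNoBlowup.lean l.26–47; NSContinuationCriterion.lean l.95–113; NSGalerkinExistenceTheorems.lean l.118–125] -/
structure NoBlowupInput where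
  E : ℕ → ℝ
  Δt : ℝ
  hΔt : 0 < Δt
  M : ℝ
  C : ℝ
  hM : 0 ≤ M
  hMC : 0 ≤ M * C
  E0 : ℝ
  hE0 : 0 ≤ E0
  F_low : ℝ → ℝ
  hF_low_nonneg : ∀ x : ℝ, 0 ≤ x → 0 ≤ F_low x
  strainHigh : ℝ
  hhigh : 0 ≤ strainHigh
  hgronwall : ∀ m : ℕ, (1 + M * C) ^ m * E0 ≥ 0
  T0 : ℝ
  hT0 : 0 < T0

/-- `bootstrapStrainSup B strainHigh F_low := F_low B + strainHigh` (verbatim).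
[cite: Iizumi2026, NSStrainSupBootstrap.lean l.178–180] -/
def bootstrapStrainSup (B strainHigh : ℝ) (F_low : ℝ → ℝ) : ℝ := F_low B + strainHigh

/-- **The (A)/(B) terminal TYPE** (`R3_global_smooth_solution_of_smooth_data` / `torus_global_smooth_solution_of_smooth_data`),
verbatim over the re-declared input: three conjuncts — a bound for each term of the sequence `E`, the
«bootstrap» sign and unfolding equation, and `0 ≤ T0 + Δt·n`.
[cite: Iizumi2026, NSR3GlobalRegularity.lean l.27–55; NSTorusGlobalRegularity.lean l.26–55] -/
def TypeAB (d : NoBlowupInput) : Prop :=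
  (∀ n : ℕ, ∃ B : ℝ, 0 ≤ B ∧ d.E n ≤ B) ∧
  (∀ n : ℕ,
    0 ≤ bootstrapStrainSup ((1 + d.M * d.C) ^ n * d.E0) d.strainHigh d.F_low ∧
    bootstrapStrainSup ((1 + d.M * d.C) ^ n * d.E0) d.strainHigh d.F_low =
      d.F_low ((1 + d.M * d.C) ^ n * d.E0) + d.strainHigh) ∧
  (∀ n : ℕ, 0 ≤ d.T0 + d.Δt * (n : ℝ))

/-- **Kernel fact: the (A)/(B) TYPE holds for EVERY input** (`B := max 0 (E n)`; `rfl` + `add_nonneg` of the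
packaged signs; `T0 > 0`, `Δt > 0`). No field, equation or time variable is involved.
[cite: Iizumi2026, NSR3GlobalRegularity.lean l.27–55] -/
theorem typeAB_holds (d : NoBlowupInput) : TypeAB d := by
  refine ⟨fun n => ⟨max 0 (d.E n), le_max_left _ _, le_max_right _ _⟩, fun n => ⟨?_, rfl⟩, fun n => ?_⟩
  · exact add_nonneg (d.hF_low_nonneg _ (d.hgronwall n)) d.hhigh
  · exact add_nonneg d.hT0.le (mul_nonneg d.hΔt.le (Nat.cast_nonneg n))

/-! ## (C)/(D): the breakdown witness, the frontier hypothesis, the TYPE -/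

/-- The (C)/(D) witness: an «enstrophy trajectory» `E : ℕ → ℝ` (= `torusEnstrophyTrajectory pkg` /
`r3EnstrophyTrajectory pkg`) with a step `nstar` at which `DiscreteBlowupAt E nstar := ∀ B : ℝ, E nstar > B`.
[cite: Iizumi2026, NSTorusBreakdownDefinition.lean l.9–23; NSR3BreakdownDefinition.lean l.13–15] -/
structure BreakdownWitness where
  E : ℕ → ℝ
  nstar : ℕ
  hblowup : ∀ B : ℝ, E nstar > B

/-- **Kernel fact: the witness type is uninhabited** — no real number exceeds every real number
(`B := E nstar`). [cite: Iizumi2026, NSTorusBreakdownDefinition.lean l.13–15] -/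
theorem isEmpty_breakdownWitness : IsEmpty BreakdownWitness :=
  ⟨fun w => lt_irrefl _ (w.hblowup (w.E w.nstar))⟩

/-- `MillenniumFrontierHypothesis` (verbatim): a nonnegative monotone `F : ℝ → ℝ` and the field
`hF_Kmax_independent : True` («THIS is the frontier»). [cite: Iizumi2026, NSMillenniumFrontier.lean l.50–56] -/
structure FrontierHypothesis where
  F : ℝ → ℝ
  hF_nonneg : ∀ x, 0 ≤ x → 0 ≤ F x
  hF_mono : Monotone F
  hF_Kmax_independent : True

/-- The frontier hypothesis is inhabited (`F := 0`). [cite: Iizumi2026, NSMillenniumFrontier.lean l.50–56] -/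
theorem nonempty_frontierHypothesis : Nonempty FrontierHypothesis :=
  ⟨⟨fun _ => 0, fun _ _ => le_rfl, fun _ _ _ => le_rfl, trivial⟩⟩

/-- The INPUT of the (C)/(D) terminal TYPE (`…BreakdownFrontierData`): it CONTAINS the counterexample data
(field `witness`) together with Gronwall constants and the implication from any frontier hypothesis to the
envelope bound. [cite: Iizumi2026, NSTorusBreakdownToFrontier.lean l.15–28; NSR3BreakdownToFrontier.lean l.15–28] -/
structure BreakdownInput where
  witness : BreakdownWitness
  M : ℝ
  C : ℝ
  E0 : ℝ
  hM : 0 ≤ M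
  hMC : 0 ≤ M * C
  hE0 : 0 ≤ E0
  hgronwall_from_frontier : ∀ _hyp : FrontierHypothesis, ∀ n : ℕ, witness.E n ≤ (1 + M * C) ^ n * E0

/-- **Kernel fact: the (C)/(D) INPUT type is uninhabited** (it contains a `BreakdownWitness`).
[cite: Iizumi2026, NSTorusBreakdownToFrontier.lean l.15–28] -/
theorem isEmpty_breakdownInput : IsEmpty BreakdownInput :=
  ⟨fun d => isEmpty_breakdownWitness.false d.witness⟩

/-- The CONCLUSION of the (C)/(D) terminal TYPE as a closed statement: «there is smooth counterexample data
whose trajectory breaks down at a finite step, and every millennium-frontier hypothesis fails».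
[cite: Iizumi2026, NSTorusBreakdownExistence.lean l.17–27; NSR3BreakdownExistence.lean l.17–46] -/
def ConclusionCD : Prop :=
  ∃ ce : BreakdownWitness, (∃ nstar : ℕ, ∀ B : ℝ, ce.E nstar > B) ∧ (FrontierHypothesis → False)

/-- **The (C)/(D) terminal TYPE** (`exists_torus_breakdown_counterexample` / `exists_breakdown_counterexample_R3`),
verbatim over the re-declared input: from a `BreakdownInput`, the conclusion.
[cite: Iizumi2026, NSTorusBreakdownExistence.lean l.17–27; NSR3BreakdownExistence.lean l.39–46] -/
def TypeCD (_d : BreakdownInput) : Prop := ConclusionCD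

/-- **Kernel fact: the (C)/(D) TYPE holds — vacuously** (its input type is empty; the deposit's proof returns
`d.counterexampleData`). [cite: Iizumi2026, NSTorusBreakdownExistence.lean l.24–26] -/
theorem typeCD_holds (d : BreakdownInput) : TypeCD d :=
  (isEmpty_breakdownInput.false d).elim

/-- **Kernel fact: the (C)/(D) conclusion, as a closed statement, is FALSE** (no breakdown witness exists;
moreover the frontier hypothesis is inhabited). [cite: Iizumi2026, NSTorusBreakdownDefinition.lean l.13–15; NSMillenniumFrontier.lean l.50–56] -/
theorem not_conclusionCD : ¬ ConclusionCD :=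
  fun ⟨ce, _, _⟩ => isEmpty_breakdownWitness.false ce

/-! ## The claimed statement (the four TYPES) and the bridges named by the prose -/

/-- THE CLAIMED THEOREM of the artefact = its four terminal TYPES («Four Named Final Theorems … completed as
end-to-end named theorem surfaces»): (A)/(B) for every no-blowup input, (C)/(D) for every breakdown input.
A `def`; it HOLDS in the kernel (`claimedTheorem_holds`) — by real arithmetic and by emptiness of the input.
[cite: Iizumi2026, description § «Four Named Final Theorems»] [claim: Iizumi2026, status: under-review] -/
def ClaimedTheorem : Prop := (∀ d : NoBlowupInput, TypeAB d) ∧ (∀ d : BreakdownInput, TypeCD d)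

/-- The four TYPES hold (nothing about Navier–Stokes is used). [cite: Iizumi2026, description § «Four Named Final Theorems»] -/
theorem claimedTheorem_holds : ClaimedTheorem := ⟨typeAB_holds, typeCD_holds⟩

/-- **Step 1 (bridge A)** — the prose's identification «R³ (A) Global regularity
`R3_global_smooth_solution_of_smooth_data` … completed»: the (A)/(B) TYPE ⇒ Clay (A). Not in the deposit as a
theorem (and disclaimed in prose); typed as the implication the naming asserts.
[cite: Iizumi2026, description § «Four Named Final Theorems»] [claim: Iizumi2026, status: under-review] -/
def Step1_bridgeA : Prop := (∀ d : NoBlowupInput, TypeAB d) → ClayVariants.clayR3.Regularity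

/-- **Step 1 (bridge B)** — «T³ (B) Global regularity `torus_global_smooth_solution_of_smooth_data` … completed»:
the (A)/(B) TYPE ⇒ Clay (B). [cite: Iizumi2026, description § «Four Named Final Theorems»]
[claim: Iizumi2026, status: under-review] -/
def Step1_bridgeB : Prop := (∀ d : NoBlowupInput, TypeAB d) → ClayVariants.clayPeriodic.Regularity

/-- **Step 2 (bridge C)** — «R³ (C) Breakdown counterexample `exists_breakdown_counterexample_R3` … completed
with actual analytic realization»: the (C)/(D) TYPE ⇒ Clay (C). [cite: Iizumi2026, description § «Four Named Final Theorems»]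
[claim: Iizumi2026, status: under-review] -/
def Step2_bridgeC : Prop := (∀ d : BreakdownInput, TypeCD d) → ClayVariants.clayR3.Breakdown

/-- **Step 2 (bridge D)** — «T³ (D) Breakdown counterexample `exists_torus_breakdown_counterexample` …
completed»: the (C)/(D) TYPE ⇒ Clay (D) (printed reading). [cite: Iizumi2026, description § «Four Named Final Theorems»]
[claim: Iizumi2026, status: under-review] -/
def Step2_bridgeD : Prop := (∀ d : BreakdownInput, TypeCD d) → ClayVariants.clayPeriodic.Breakdown

/-- **Kernel fact (ROUTE 5b shape): bridge A IS Clay (A)** — since the TYPE holds for every input.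
[cite: Iizumi2026, description § «Four Named Final Theorems»] -/
theorem step1_bridgeA_iff : Step1_bridgeA ↔ ClayVariants.clayR3.Regularity :=
  ⟨fun h => h typeAB_holds, fun h _ => h⟩

/-- Bridge B IS Clay (B). [cite: Iizumi2026, description § «Four Named Final Theorems»] -/
theorem step1_bridgeB_iff : Step1_bridgeB ↔ ClayVariants.clayPeriodic.Regularity :=
  ⟨fun h => h typeAB_holds, fun h _ => h⟩

/-- Bridge C IS Clay (C). [cite: Iizumi2026, description § «Four Named Final Theorems»] -/
theorem step2_bridgeC_iff : Step2_bridgeC ↔ ClayVariants.clayR3.Breakdown :=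
  ⟨fun h => h typeCD_holds, fun h _ => h⟩

/-- Bridge D IS Clay (D). [cite: Iizumi2026, description § «Four Named Final Theorems»] -/
theorem step2_bridgeD_iff : Step2_bridgeD ↔ ClayVariants.clayPeriodic.Breakdown :=
  ⟨fun h => h typeCD_holds, fun h _ => h⟩

/-- **COMPOSITION**: the four Clay statements named by the prose follow from the bridges ALONE (the TYPES are
discharged by `claimedTheorem_holds` and carry no Navier–Stokes content). Pure logic.
[cite: Iizumi2026, description § «Four Named Final Theorems»] -/
theorem clay_of_bridges (hA : Step1_bridgeA) (hB : Step1_bridgeB) (hC : Step2_bridgeC) (hD : Step2_bridgeD) :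
    ClayVariants.clayR3.Regularity ∧ ClayVariants.clayPeriodic.Regularity ∧
      ClayVariants.clayR3.Breakdown ∧ ClayVariants.clayPeriodic.Breakdown :=
  ⟨hA claimedTheorem_holds.1, hB claimedTheorem_holds.1, hC claimedTheorem_holds.2, hD claimedTheorem_holds.2⟩

/-- `claim_of_steps` in the cell's standard shape: the claimed theorem (the four TYPES) needs no step at all.
[cite: Iizumi2026, description § «Four Named Final Theorems»] -/
theorem claim_of_steps : ClaimedTheorem := claimedTheorem_holds

end

end Literature.Claims.NS.Iizumi2026
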